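import Literature.NumberTheory.EllipticCurves.HeegnerTraceRelationOrdersAdapter
import Literature.NumberTheory.EllipticCurves.HeegnerFormsConductorMul
import Literature.NumberTheory.EllipticCurves.HeegnerTraceRelationProofs
import HarnessLib

/-!
# The trace relation `Tr_{K[ℓf]/K[f]} φ(x') = a_ℓ · φ(x)` for CM points of an ARBITRARY order on
# `X₀(N)` — Gross 1991 Prop. 3.7 (1) / Nekovář 2007 Prop. 4.13 (i) WITHOUT `gcd(N, d_K) = 1` — PROVED

Topic `NumberTheory/EllipticCurves` (complex multiplication / CM points; sequel of
`HeegnerPointsHeckeOrbitOrders`, `HeegnerTraceRelationProofs`, `EichlerIntegralHeckeProofs`),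
namespace `Literature.NumberTheory.EllipticCurves`.  THEOREMS ONLY: no definition, no named fact
(D-0026); unconditional.

`HeegnerTraceRelationProofs.lean` proves Gross's *"`Tr_ℓ y_n = a_ℓ · y_m` in `E(K_m)`"* (1991,
Prop. 3.7 (1), PDF p. 217 l. 19 – p. 218 l. 8 of `book:editornd-l-functions-arithmetic`) for the
Heegner points `x(m) = heegnerPointOfConductor d_K β m` under `gcd(N, d_K) = 1`, `gcd(N, m) = 1`
(`GrossLMS1991.prop37_1_traceRelation_holds`).  Its two halves are

* GALOIS: `Gal(K[ℓm]/K[m])` is simply transitive on the `ℓ + 1` points of `T_ℓ(x(m))`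
  (`HeegnerPointsHeckeOrbit.lean`), and
* ANALYTIC: Eichler–Shimura `a_ℓ • φ(τ) = Σ_{j mod ℓ} φ((τ+j)/ℓ) + φ(ℓτ)` for `ℓ ∤ N`
  (`ModularParametrizationData.lFunction_zsmul_φ_of_not_dvd`, Knapp Thm. 11.74 (b)) with the
  `ℚ`-rationality of `φ` in transport form (`transport_weierstrassP_values`, Shimura Thm. 7.14),

of which only the first used `gcd(N, d_K) = 1`.  `HeegnerPointsHeckeOrbitOrders.lean` re-proves the
Galois half for a `K[f]`-rational point `x` of `Y₀(N)` (transport form `hfix`, e.g. the root `τ_Q` of a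
level-`N` Heegner form `Q` of discriminant `f² d_K` with Bezout data — CM by the order `𝒪_f`, any
`gcd(N, f d_K)`) and a Hecke `ℓ`-neighbour `x' = τ_{Q'}` of `x` with `Q'` primitive positive definite
of discriminant `(ℓf)² d_K` (e.g. `x/ℓ`).  This file and its predecessor
`HeegnerTraceRelationOrdersAdapter.lean` (§§1–3: `#G_ℓ = ℓ + 1`, extension of `g ∈ G_ℓ` to `Aut(ℂ/K[f])`,
the ADAPTER `exists_heckeOrbitIndex_bijective_of_fix`) assemble the relation EXACTLY as
`HeegnerTraceRelationProofs` §§1–4 do (its conductor-independent private plumbing copied verbatim):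

* §2′ `σ ⋆ φ(τ) = φ(τ')` along `LevelTransport` (any `τ, τ'`), `(g • P)_ℂ = σ ⋆ P_ℂ`;
* §4 **`map_sum_pointGalHom_eq_lFunction_smul_of_fix`** — for `y ∈ E(K[ℓf])` over `φ(x')` and any
  finset enumerating `G_ℓ`: `(Σ_{g ∈ G_ℓ} g • y)_ℂ = a_ℓ • φ(x)` in `E(ℂ)` with `a_ℓ = W.LFunction ℓ`
  (ANY model `W/ℚ`, any `Dt : ModularParametrizationData W N`); the `∑ᶠ`/`frobeniusTrace` form
  `finsum_mem_ringClassGalOver_eq_frobeniusTrace_smul_of_fix` for a globally minimal `W` with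
  `N = N_E`; and the identity read inside `E(K[ℓf])` (`sum_pointGalHom_eq_lFunction_smul_of_fix`:
  `Σ g • y = a_ℓ • y₀` for `y₀ ∈ E(K[ℓf])` over `φ(x)`, by injectivity of `E(K[ℓf]) → E(ℂ)`), and
  the BEZOUT/`x/ℓ` form `sum_pointGalHom_eq_lFunction_smul_bezout` (base `τ_Q`, moving point
  `τ_{(ℓ²A, ℓB, C)} = τ_Q/ℓ`, `HeegnerFormsConductorMul.lean`).

In print this is Nekovář 2007, Prop. (4.13) (i) *"`Tr y(𝔫ℓ) = a_ℓ y(𝔫)`"* (Euler system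
relations for CM points of arbitrary conductor on Shimura curves `N_H`, here `B = M₂(ℚ)`,
`H = Γ̂₀(N)`, PDF p. 0573 of `book:burns2007-l-functions-galois-representations`, invoked verbatim by
Cai–Shu–Tian 2017 p. 11 for conductor-`6N` CM points on `X₀(36)`), and Gross 1991 Prop. 3.7 (1) for
CM points by non-maximal orders including `3 ∣ gcd(N, f)` (Hu–Shu–Yin 2019: `φ : X₀(3⁵) → E_9`,
`P₁ = [τ, 1]`, `τ = (2pω − 9)/(9pω − 36)` of conductor `9p`, arXiv 1708.05266 p. 10).  No tree
theorem covered these cases.  The units hypothesis `f ≥ 2 ∨ d_K < −4` is Nekovář's `u(r) = 1`.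

## References
* B. H. Gross, *Kolyvagin's work on modular elliptic curves*, LMS LNS 153 (1991), Prop. 3.7 (1) and
  its proof (PDF p. 217 l. 19 – p. 218 l. 8). [GrossLMS1991]
* J. Nekovář, *The Euler system method for CM points on Shimura curves*, LMS LNS 320 (2007),
  Prop. (4.8), Prop. (4.13) (i) (PDF p. 0570, p. 0573). [Nekovar2007]
* A. W. Knapp, *Elliptic Curves* (1993), Thm. 11.74 (b). [Knapp1993]
* G. Shimura, *Introduction to the arithmetic theory of automorphic functions* (1971), Thm. 7.14,
  §7.3. [ShimuraIATAF1971]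
* L. Cai, J. Shu, Y. Tian, *Cube sum problem and an explicit Gross–Zagier formula*, Amer. J. Math.
  139 (2017), p. 11 (use of [Nek] for CM points of conductor `6N`). [CaiShuTian2017]

## Mathlib / tree search
Tree, by name (all Literature): `ringClassGalOver`, `ringClassGalOver_le_ringClassGal`,
`smul_algebraMap_of_mem_ringClassGal`, `finiteDimensional_and_isGalois_ringClassField`,
`coe_algebraMap_ringClassField`, `pointGalHom_apply` (`HeegnerPointsOfConductor`);
`RingClassField.subfieldIn`, `mem_subfieldIn_iff`, `finrank_subfieldIn_ringClassField_eq_succ`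
(`RingClassFieldTower`); `exists_ringEquiv_apply_eq_algEquiv` (`RingClassFieldGenerator`);
`exists_isHeckeNeighbour_levelTransport_of_fix'`,
`eqOn_ringClassField_of_levelTransport_of_gamma0_smul_eq_of_formJ`,
`levelTransport_self_of_fix_ringClassField_bezout` (`HeegnerPointsHeckeOrbitOrders`);
`exists_gamma0_smul_eq_of_isHeckeNeighbour` (`HeckeNeighbourTransport`);
`ModularParametrizationData.transport_weierstrassP_values`, `uniformize_spec`, `uniformize_eq_zero_iff`;
`lFunction_zsmul_φ_of_not_dvd` (`EichlerIntegralHeckeProofs`); `LFunction_apply_prime_eq_frobeniusTrace`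
(`LFunctionPrimeCoeff`).  Statements generalised: the private §§1–4 of `HeegnerTraceRelationProofs`
and its `finsum_mem_ringClassGalOver_eq_frobeniusTrace_smul`.
`lean search 'lFunction_smul_of_fix|heckeOrbitIndex_bijective_of_fix'` → nothing before this file.
presearch: [corpus:book:editornd-l-functions-arithmetic p0217:L19–26, p0218:L1–8] (Gross);
[corpus:book:burns2007-l-functions-galois-representations p0570, p0573] (Nekovář (4.8), (4.13));
[corpus:paper:arxiv-1708.05266 p0010:L92] (HSY's `P₁`); port of tree proofs, nothing newer needed.
-/

noncomputable section

open scoped Classical MatrixGroups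
open Complex UpperHalfPlane CongruenceSubgroup NumberField Module
open Literature.NumberTheory.EllipticCurves.RingClassField
open Literature.NumberTheory.EllipticCurves.ModularForms

namespace Literature.NumberTheory.EllipticCurves

open Literature.NumberTheory.QuadraticFields.BinaryQuadraticForm
  Literature.NumberTheory.QuadraticFields.Quadratic

namespace HeegnerTraceOrders

variable {K : Type} [Field K] [NumberField K]

/-! ## §2′ `φ` along level transport; `(g • P)_ℂ = σ ⋆ P_ℂ` -/

/-- **`σ ⋆ φ(τ) = φ(τ')` whenever `σ ∈ Aut(ℂ)` transports the level-`N` structure of `τ` to that of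
`τ'`**, for every modular parametrisation datum `Dt` of `W/ℚ` and all `τ, τ' ∈ ℍ` (copy of the
private helper of `HeegnerTraceRelationProofs`). [cite: ShimuraIATAF1971, Thm. 7.14]
[cite: Darmon2004, Thm. 3.6 (proof)] -/
private theorem map_φ_of_levelTransport {W : WeierstrassCurve ℚ} {N : ℕ} [NeZero N]
    (Dt : ModularParametrizationData W N) {σ : ℂ ≃+* ℂ} {τ τ' : ℍ}
    (hT : LevelTransport N σ τ τ') :
    WeierstrassCurve.Affine.Point.map (σ : ℂ →+* ℂ).toRatAlgHom (Dt.φ τ) = Dt.φ τ' := by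
  obtain ⟨hiff, hval⟩ := Dt.transport_weierstrassP_values σ hT
  set z : ℂ := (Dt.c : ℂ) * eichlerIntegral Dt.f τ with hz_def
  set z' : ℂ := (Dt.c : ℂ) * eichlerIntegral Dt.f τ' with hz'_def
  change WeierstrassCurve.Affine.Point.map _ (Dt.uniformize z) = Dt.uniformize z'
  by_cases hz : z ∈ Dt.L.lattice
  · rw [(Dt.uniformize_eq_zero_iff z).mpr hz, (Dt.uniformize_eq_zero_iff z').mpr (hiff.mp hz),
      map_zero]
  · have hz' : z' ∉ Dt.L.lattice := fun h' => hz (hiff.mpr h')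
    obtain ⟨h₁, h₂⟩ := hval hz
    obtain ⟨hn, hspec⟩ := Dt.uniformize_spec z hz
    obtain ⟨hn', hspec'⟩ := Dt.uniformize_spec z' hz'
    have hσq : ∀ q : ℚ, σ (algebraMap ℚ ℂ q) = algebraMap ℚ ℂ q := fun q => by
      rw [eq_ratCast, map_ratCast]
    rw [hspec, hspec', WeierstrassCurve.Affine.Point.map_some,
      WeierstrassCurve.Affine.Point.some.injEq]
    refine ⟨?_, ?_⟩
    · simp only [RingHom.toRatAlgHom_apply, RingEquiv.coe_toRingHom, WeierstrassCurve.baseChange,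
        WeierstrassCurve.map_b₂, map_sub, map_div₀, map_ofNat, hσq, h₁]
    · simp only [RingHom.toRatAlgHom_apply, RingEquiv.coe_toRingHom, WeierstrassCurve.baseChange,
        WeierstrassCurve.map_b₂, WeierstrassCurve.map_a₁, WeierstrassCurve.map_a₃, map_sub,
        map_div₀, map_mul, map_ofNat, hσq, h₁, h₂]

/-- **`(g • P)_ℂ = σ ⋆ P_ℂ`** when `σ ∈ Aut(ℂ)` restricts to `g ∈ Aut_ℚ(K[n])` on `K[n] ⊂ ℂ`
(copy of the private helper of `HeegnerTraceRelationProofs`). [folklore] -/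
private theorem map_subtype_pointGalHom_eq {W : WeierstrassCurve ℚ} (ι : K →+* ℂ) {n : ℕ}
    (g : ringClassField K ι n ≃ₐ[ℚ] ringClassField K ι n) {σ : ℂ ≃+* ℂ}
    (hσ : ∀ x : ringClassField K ι n, σ x = ((g x : ringClassField K ι n) : ℂ))
    (P : (W.baseChange (ringClassField K ι n)).toAffine.Point) :
    WeierstrassCurve.Affine.Point.map (W' := W) (ringClassField K ι n).subtype.toRatAlgHom
        (pointGalHom W (ringClassField K ι n) g P) =
      WeierstrassCurve.Affine.Point.map (W' := W) (σ : ℂ →+* ℂ).toRatAlgHom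
        (WeierstrassCurve.Affine.Point.map (W' := W) (ringClassField K ι n).subtype.toRatAlgHom P) := by
  have h : (ringClassField K ι n).subtype.toRatAlgHom.comp
      (g : ringClassField K ι n →ₐ[ℚ] ringClassField K ι n) =
      (σ : ℂ →+* ℂ).toRatAlgHom.comp (ringClassField K ι n).subtype.toRatAlgHom :=
    AlgHom.ext fun x => (hσ x).symm
  rw [pointGalHom_apply, WeierstrassCurve.Affine.Point.map_map,
    WeierstrassCurve.Affine.Point.map_map, h]

/-! ## §4 The trace relation in `E(ℂ)` and in `E(K[ℓf])` -/

/-- **Gross's Prop. 3.7 (1) / Nekovář's (4.13) (i) in `E(ℂ)` for a CM point of conductor `f`.**  Let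
`K` be imaginary quadratic, `ι : K → ℂ`, `W/ℚ` any model with a modular parametrisation datum
`Dt : ModularParametrizationData W N` (`φ = Dt.φ`, `φ(∞) = O`), `x ∈ ℍ` a point whose point of `Y₀(N)`
is fixed by `Aut(ℂ/K[f])` (`hfix`; e.g. `x = τ_Q`, `levelTransport_self_of_fix_ringClassField_bezout`),
`ℓ` a prime inert in `K` with `ℓ ∤ N`, `ℓ ∤ f`, `f ≥ 1`, `f ≥ 2` or `d_K < −4`, and `x' = τ_{Q'}` a
Hecke `ℓ`-neighbour of `x` with `Q'` primitive positive definite of discriminant `(ℓf)² d_K`.  Then for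
any finset `G` enumerating `G_ℓ = Gal(K[ℓf]/K[f])` and any `y ∈ E(K[ℓf])` lying over `φ(x')`:
`(Σ_{g ∈ G} g • y)_ℂ = a_ℓ • φ(x)` with `a_ℓ = W.LFunction ℓ`.  Proof: each `(g • y)_ℂ` is
`σ_g ⋆ φ(x') = φ(std (i g))` for the bijection of `exists_heckeOrbitIndex_bijective_of_fix`; reindex
and apply the Hecke sum `lFunction_zsmul_φ_of_not_dvd`.
[cite: GrossLMS1991, §3 Prop. 3.7 (1) (proof, PDF p. 217 l. 24 – p. 218 l. 1)]
[cite: Nekovar2007, Prop. (4.13) (i) (p. 0573)] [cite: Knapp1993, Thm. 11.74 (b)] -/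
theorem map_sum_pointGalHom_eq_lFunction_smul_of_fix (hK : IsImaginaryQuadratic K) (ι : K →+* ℂ)
    {N : ℕ} [NeZero N] {W : WeierstrassCurve ℚ} (Dt : ModularParametrizationData W N)
    {f ℓ : ℕ} (hℓ : ℓ.Prime) (hinert : (Ideal.span {(ℓ : 𝓞 K)}).IsPrime) (hℓN : ¬ ℓ ∣ N)
    (hℓf : ¬ ℓ ∣ f) (hf : f ≠ 0) (hunits : 2 ≤ f ∨ NumberField.discr K < -4) {x : ℍ}
    (hfix : ∀ σ : ℂ ≃+* ℂ, (∀ z ∈ ringClassField K ι f, σ z = z) → LevelTransport N σ x x)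
    {Q' : ℤ × ℤ × ℤ} (hQ'1 : 0 < Q'.1) (hQ'prim : IsPrimitive Q')
    (hQ'disc : discr Q' = ((ℓ * f : ℕ) : ℤ) ^ 2 * NumberField.discr K)
    (hx' : IsHeckeNeighbour N ℓ x (heegnerTau Q'))
    {G : Finset (ringClassField K ι (ℓ * f) ≃ₐ[ℚ] ringClassField K ι (ℓ * f))}
    (hG : ∀ g, g ∈ G ↔ g ∈ ringClassGalOver ι (ℓ * f) f)
    {y : (W.baseChange (ringClassField K ι (ℓ * f))).toAffine.Point}
    (hy : WeierstrassCurve.Affine.Point.map (W' := W)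
        (ringClassField K ι (ℓ * f)).subtype.toRatAlgHom y = Dt.φ (heegnerTau Q')) :
    WeierstrassCurve.Affine.Point.map (W' := W) (ringClassField K ι (ℓ * f)).subtype.toRatAlgHom
        (∑ g ∈ G, pointGalHom W (ringClassField K ι (ℓ * f)) g y) = W.LFunction ℓ • Dt.φ x := by
  haveI : NeZero ℓ := ⟨hℓ.ne_zero⟩
  obtain ⟨σ, i, hi, hσ⟩ := exists_heckeOrbitIndex_bijective_of_fix hK ι hℓ hinert hℓN hℓf hf hunits
    hfix hQ'1 hQ'prim hQ'disc hx'
  -- the `ℓ + 1` points of `T_ℓ(x)`, indexed by `Option (Fin ℓ)`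
  let F : Option (Fin ℓ) → (W.baseChange ℂ).toAffine.Point := fun o =>
    Dt.φ (o.elim (tpD ℓ • x) (fun j => tpB ℓ ((j : ℕ) : ℤ) • x))
  -- each conjugate `(g • y)_ℂ` is the `φ`-image of the indexed point of `T_ℓ(x)`
  have hterm : ∀ g (hg : g ∈ G),
      WeierstrassCurve.Affine.Point.map (W' := W) (ringClassField K ι (ℓ * f)).subtype.toRatAlgHom
          (pointGalHom W (ringClassField K ι (ℓ * f)) g y) = F (i ⟨g, (hG g).1 hg⟩) := by
    intro g hg
    obtain ⟨-, hext, hT⟩ := hσ ⟨g, (hG g).1 hg⟩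
    rw [map_subtype_pointGalHom_eq ι g hext y, hy]
    exact map_φ_of_levelTransport Dt hT
  rw [map_sum, Finset.sum_bij (t := Finset.univ) (g := F) (fun g hg => i ⟨g, (hG g).1 hg⟩)
    (fun _ _ => Finset.mem_univ _)
    (fun a₁ ha₁ a₂ ha₂ h => congrArg Subtype.val (hi.1 h))
    (fun b _ => by
      obtain ⟨⟨a, ha⟩, rfl⟩ := hi.2 b
      exact ⟨a, (hG a).2 ha, rfl⟩)
    hterm, Fintype.sum_option, Dt.lFunction_zsmul_φ_of_not_dvd ℓ hℓ hℓN, add_comm]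
  rfl

/-- The same at a level written `n = ℓ * f` (use at `K[n]` without transporting along the arithmetic
identity). [cite: GrossLMS1991, §3 Prop. 3.7 (1)] [cite: Nekovar2007, Prop. (4.13) (i) (p. 0573)] -/
theorem map_sum_pointGalHom_eq_lFunction_smul_of_fix_of_eq (hK : IsImaginaryQuadratic K)
    (ι : K →+* ℂ) {N : ℕ} [NeZero N] {W : WeierstrassCurve ℚ} (Dt : ModularParametrizationData W N)
    {f ℓ n : ℕ} (hℓ : ℓ.Prime) (hinert : (Ideal.span {(ℓ : 𝓞 K)}).IsPrime) (hℓN : ¬ ℓ ∣ N)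
    (hℓf : ¬ ℓ ∣ f) (hf : f ≠ 0) (hunits : 2 ≤ f ∨ NumberField.discr K < -4) (hn : ℓ * f = n)
    {x : ℍ} (hfix : ∀ σ : ℂ ≃+* ℂ, (∀ z ∈ ringClassField K ι f, σ z = z) → LevelTransport N σ x x)
    {Q' : ℤ × ℤ × ℤ} (hQ'1 : 0 < Q'.1) (hQ'prim : IsPrimitive Q')
    (hQ'disc : discr Q' = (n : ℤ) ^ 2 * NumberField.discr K)
    (hx' : IsHeckeNeighbour N ℓ x (heegnerTau Q'))
    {G : Finset (ringClassField K ι n ≃ₐ[ℚ] ringClassField K ι n)}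
    (hG : ∀ g, g ∈ G ↔ g ∈ ringClassGalOver ι n f)
    {y : (W.baseChange (ringClassField K ι n)).toAffine.Point}
    (hy : WeierstrassCurve.Affine.Point.map (W' := W)
        (ringClassField K ι n).subtype.toRatAlgHom y = Dt.φ (heegnerTau Q')) :
    WeierstrassCurve.Affine.Point.map (W' := W) (ringClassField K ι n).subtype.toRatAlgHom
        (∑ g ∈ G, pointGalHom W (ringClassField K ι n) g y) = W.LFunction ℓ • Dt.φ x := by
  subst hn
  exact map_sum_pointGalHom_eq_lFunction_smul_of_fix hK ι Dt hℓ hinert hℓN hℓf hf hunits hfix hQ'1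
    hQ'prim hQ'disc hx' hG hy

/-- **The `∑ᶠ` form with `a_ℓ = W.frobeniusTrace ℓ`**: for a globally minimal `W` with `N = N_E`
(so `ℓ ∤ N_E` is a good prime and `W.LFunction ℓ = W.frobeniusTrace ℓ`), at a level `n = ℓ f`,
`∑ᶠ σ ∈ G_ℓ, (σ • y)_ℂ = a_ℓ • φ(x)`.  Twin of `finsum_mem_ringClassGalOver_eq_frobeniusTrace_smul`
for CM points of conductor `f` without `gcd(N_E, f d_K) = 1`.
[cite: GrossLMS1991, §3 Prop. 3.7 (1)] [cite: Nekovar2007, Prop. (4.13) (i) (p. 0573)] -/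
theorem finsum_mem_ringClassGalOver_eq_frobeniusTrace_smul_of_fix (hK : IsImaginaryQuadratic K)
    (ι : K →+* ℂ) {W : WeierstrassCurve ℚ} [W.IsElliptic] [W.IsGloballyMinimal]
    [NeZero (W.conductorNorm ℤ)] (Dt : ModularParametrizationData W (W.conductorNorm ℤ))
    {f ℓ n : ℕ} (hℓ : ℓ.Prime) (hinert : (Ideal.span {(ℓ : 𝓞 K)}).IsPrime)
    (hℓN : ¬ ℓ ∣ W.conductorNorm ℤ) (hℓf : ¬ ℓ ∣ f) (hf : f ≠ 0)
    (hunits : 2 ≤ f ∨ NumberField.discr K < -4) (hn : ℓ * f = n) {x : ℍ}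
    (hfix : ∀ σ : ℂ ≃+* ℂ, (∀ z ∈ ringClassField K ι f, σ z = z) →
      LevelTransport (W.conductorNorm ℤ) σ x x)
    {Q' : ℤ × ℤ × ℤ} (hQ'1 : 0 < Q'.1) (hQ'prim : IsPrimitive Q')
    (hQ'disc : discr Q' = (n : ℤ) ^ 2 * NumberField.discr K)
    (hx' : IsHeckeNeighbour (W.conductorNorm ℤ) ℓ x (heegnerTau Q'))
    {y : (W.baseChange (ringClassField K ι n)).toAffine.Point}
    (hy : WeierstrassCurve.Affine.Point.map (W' := W)
        (ringClassField K ι n).subtype.toRatAlgHom y = Dt.φ (heegnerTau Q')) :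
    ∑ᶠ σ ∈ (ringClassGalOver ι n f : Set (ringClassField K ι n ≃ₐ[ℚ] ringClassField K ι n)),
        WeierstrassCurve.Affine.Point.map (W' := W) (ringClassField K ι n).subtype.toRatAlgHom
          (pointGalHom W (ringClassField K ι n) σ y) = (W.frobeniusTrace ℓ) • Dt.φ x := by
  have hn0 : n ≠ 0 := by rw [← hn]; exact mul_ne_zero hℓ.ne_zero hf
  haveI := (finiteDimensional_and_isGalois_ringClassField hK ι hn0).1
  haveI : FiniteDimensional ℚ (ringClassField K ι n) := Module.Finite.trans K (ringClassField K ι n)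
  have hfin : (ringClassGalOver ι n f : Set (ringClassField K ι n ≃ₐ[ℚ]
      ringClassField K ι n)).Finite := Set.toFinite _
  have hG : ∀ g, g ∈ hfin.toFinset ↔ g ∈ ringClassGalOver ι n f := fun g => by
    rw [Set.Finite.mem_toFinset, SetLike.mem_coe]
  haveI : Fact ℓ.Prime := ⟨hℓ⟩
  have key := map_sum_pointGalHom_eq_lFunction_smul_of_fix_of_eq hK ι Dt hℓ hinert hℓN hℓf hf hunits
    hn hfix hQ'1 hQ'prim hQ'disc hx' hG hy
  rw [map_sum, WeierstrassCurve.LFunction_apply_prime_eq_frobeniusTrace W ℓ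
    (not_not.mp (mt (W.dvd_conductorNorm_iff_not_hasGoodReductionAtPrime ℓ).mpr hℓN))] at key
  rw [finsum_mem_eq_finite_toFinset_sum _ hfin]
  exact key

/-- **The identity read inside `E(K[ℓf])`** ("in `E(K_m)`" `⊆ E(K_n)`, Gross): for `y ↦ φ(x')` and a
point `y₀ ∈ E(K[n])` with `y₀ ↦ φ(x)` (the tree's data convention, `KolyvaginHeegnerData.map_y`),
`Σ_{g ∈ G} g • y = a_ℓ • y₀` in `E(K[n])` — by injectivity of `E(K[n]) → E(ℂ)`
(Mathlib `WeierstrassCurve.Affine.Point.map_injective`).  This is the shape consumed by the tree's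
Gross 3.6 algebra (`KolyvaginEuler.grAct_traceElt_mem_of_eq_smul`, `smul_kolyvaginPoint_sub_mem`).
[cite: GrossLMS1991, Prop. 3.7 (1) (p. 240), "in E(K_m)"] [cite: Nekovar2007, Prop. (4.13) (i) (p. 0573)] -/
theorem sum_pointGalHom_eq_lFunction_smul_of_fix (hK : IsImaginaryQuadratic K)
    (ι : K →+* ℂ) {N : ℕ} [NeZero N] {W : WeierstrassCurve ℚ} (Dt : ModularParametrizationData W N)
    {f ℓ n : ℕ} (hℓ : ℓ.Prime) (hinert : (Ideal.span {(ℓ : 𝓞 K)}).IsPrime) (hℓN : ¬ ℓ ∣ N)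
    (hℓf : ¬ ℓ ∣ f) (hf : f ≠ 0) (hunits : 2 ≤ f ∨ NumberField.discr K < -4) (hn : ℓ * f = n)
    {x : ℍ} (hfix : ∀ σ : ℂ ≃+* ℂ, (∀ z ∈ ringClassField K ι f, σ z = z) → LevelTransport N σ x x)
    {Q' : ℤ × ℤ × ℤ} (hQ'1 : 0 < Q'.1) (hQ'prim : IsPrimitive Q')
    (hQ'disc : discr Q' = (n : ℤ) ^ 2 * NumberField.discr K)
    (hx' : IsHeckeNeighbour N ℓ x (heegnerTau Q'))
    {G : Finset (ringClassField K ι n ≃ₐ[ℚ] ringClassField K ι n)}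
    (hG : ∀ g, g ∈ G ↔ g ∈ ringClassGalOver ι n f)
    {y y₀ : (W.baseChange (ringClassField K ι n)).toAffine.Point}
    (hy : WeierstrassCurve.Affine.Point.map (W' := W)
        (ringClassField K ι n).subtype.toRatAlgHom y = Dt.φ (heegnerTau Q'))
    (hy₀ : WeierstrassCurve.Affine.Point.map (W' := W)
        (ringClassField K ι n).subtype.toRatAlgHom y₀ = Dt.φ x) :
    ∑ g ∈ G, pointGalHom W (ringClassField K ι n) g y = W.LFunction ℓ • y₀ := by
  apply WeierstrassCurve.Affine.Point.map_injective
    (f := (ringClassField K ι n).subtype.toRatAlgHom)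
  rw [map_zsmul, hy₀]
  exact map_sum_pointGalHom_eq_lFunction_smul_of_fix_of_eq hK ι Dt hℓ hinert hℓN hℓf hf hunits hn hfix
    hQ'1 hQ'prim hQ'disc hx' hG hy

/-- **Bezout base point, `x' = x/ℓ`** — the form in which the relation is used for a CM point
`x = τ_Q` given by a level-`N` Heegner form `Q = (A, B, C)` of discriminant `f² d_K` with Bezout data
and `ℓ ∤ C`: for `y ∈ E(K[n])` over `φ(τ_{(ℓ²A, ℓB, C)}) = φ(x/ℓ)` and `y₀ ∈ E(K[n])` over `φ(τ_Q)`,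
`Σ_{g ∈ G_ℓ} g • y = a_ℓ • y₀` (`n = ℓ f`).  Gross's `x_{ℓm} = x_m/ℓ`; Nekovář's `x(𝔫ℓ)` above `x(𝔫)`.
[cite: GrossLMS1991, Prop. 3.7 (1) (p. 240)] [cite: Nekovar2007, Prop. (4.13) (i) (p. 0573)] -/
theorem sum_pointGalHom_eq_lFunction_smul_bezout (hK : IsImaginaryQuadratic K)
    (ι : K →+* ℂ) {N : ℕ} [NeZero N] {W : WeierstrassCurve ℚ} (Dt : ModularParametrizationData W N)
    {f ℓ n : ℕ} (hℓ : ℓ.Prime) (hinert : (Ideal.span {(ℓ : 𝓞 K)}).IsPrime) (hℓN : ¬ ℓ ∣ N)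
    (hℓf : ¬ ℓ ∣ f) (hf : f ≠ 0) (hunits : 2 ≤ f ∨ NumberField.discr K < -4) (hn : ℓ * f = n)
    {Q : ℤ × ℤ × ℤ} (hQ : Q ∈ heegnerForms N ((f : ℤ) ^ 2 * NumberField.discr K)) {β c u v w : ℤ}
    (hβ : Q.2.1 ≡ β [ZMOD 2 * N]) (hc : 4 * N * c = β ^ 2 - (f : ℤ) ^ 2 * NumberField.discr K)
    (huvw : u * N + v * β + w * c = 1) (hℓC : ¬ (ℓ : ℤ) ∣ Q.2.2)
    {G : Finset (ringClassField K ι n ≃ₐ[ℚ] ringClassField K ι n)}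
    (hG : ∀ g, g ∈ G ↔ g ∈ ringClassGalOver ι n f)
    {y y₀ : (W.baseChange (ringClassField K ι n)).toAffine.Point}
    (hy : WeierstrassCurve.Affine.Point.map (W' := W)
        (ringClassField K ι n).subtype.toRatAlgHom y =
      Dt.φ (heegnerTau ((ℓ : ℤ) ^ 2 * Q.1, (ℓ : ℤ) * Q.2.1, Q.2.2)))
    (hy₀ : WeierstrassCurve.Affine.Point.map (W' := W)
        (ringClassField K ι n).subtype.toRatAlgHom y₀ = Dt.φ (heegnerTau Q)) :
    ∑ g ∈ G, pointGalHom W (ringClassField K ι n) g y = W.LFunction ℓ • y₀ := by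
  have hD : (f : ℤ) ^ 2 * NumberField.discr K < 0 :=
    mul_neg_of_pos_of_neg (pow_pos (by exact_mod_cast Nat.pos_of_ne_zero hf) 2) hK.discr_neg
  have hQℓ := conductorMul_mem_heegnerForms hQ hℓ hℓC
  have hdisc' : discr ((ℓ : ℤ) ^ 2 * Q.1, (ℓ : ℤ) * Q.2.1, Q.2.2) = (n : ℤ) ^ 2 * NumberField.discr K := by
    rw [← hn, QuadraticFields.BinaryQuadraticForm.discr_apply]
    push_cast
    linear_combination (ℓ : ℤ) ^ 2 * hQ.1
  exact sum_pointGalHom_eq_lFunction_smul_of_fix hK ι Dt hℓ hinert hℓN hℓf hf hunits hn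
    (fun σ hσ => levelTransport_self_of_fix_ringClassField_bezout hK ι hf hQ hβ hc huvw hσ)
    hQℓ.2.1 ((isPrimitive_iff_binQF _).mpr ((BinQF.isPrimitive_iff _).mpr hQℓ.2.2.2)) hdisc'
    (isHeckeNeighbour_heegnerTau_conductorMul hQ.2.1 (hQ.1.trans_lt hD) hℓ) hG hy hy₀

end HeegnerTraceOrders

end Literature.NumberTheory.EllipticCurves

end
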